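import Summits.Ventures.PercRepro.GenQColoopBridge
import Summits.Ventures.PercRepro.GenQHypAddOneAll

/-!
# PercRepro — the top-type trace sum of a set with a coloop is trivially non-negative (night-4, gen 8)

The level-`(q + 1)` trace sum on a rank-`q` set `H` at type `t = q` is
`Σ_{B ∈ R_q(H)} ((q + 3 − q)/(2 + m(B)) − ((q + 3)/(q + 2))·dem(H, q, B))` with `dem = 1` iff `rk(H ∖ B) ≥ q`.
If `H` has a coloop `a`, every rank-`q` subset `B ⊆ H` contains `a` (otherwise `B ⊆ H ∖ a`, of rank `q − 1`), so
`H ∖ B ⊆ H ∖ a` has rank `≤ q − 1` and NOTHING is demanded: the sum is `Σ_B 3/(2 + m(B)) ≥ 0`.  At `q = 6` this is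
every `m(H) ≥ 1` sub-instance of `TraceSixResidue` at type `6` — the eight «negative» cases trace t=6 m=1 d=9–16 of
the re-solved (9,7) table were an artefact of a relaxation that does not know this row (`traceSum_top_nonneg_of_coloop`).
Imports `GenQColoopBridge` (`eRk_erase_of_coloop`).
-/
namespace PercRepro.GenQ

open Finset ThmH SixFour

variable {α : Type*} [DecidableEq α] {M : Matroid α} [M.Finite]

/-- A rank-`(q + 1)` subset of `H` contains every coloop `a` of `H` (`rk H = q + 1`). -/
theorem mem_of_mem_Rq_of_coloop {H B : Finset α} {a : α} {q : ℕ} (hH : H ⊆ gr M) (ha : a ∈ H)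
    (hr : M.eRk (H : Set α) = ((q + 1 : ℕ) : ℕ∞)) (hacl : a ∉ M.closure ((H.erase a : Finset α) : Set α))
    (hB : B ∈ Rq M H (q + 1)) : a ∈ B := by
  by_contra hab
  have hB' := mem_Rq.1 hB
  have hsub : B ⊆ H.erase a := by
    intro x hx
    rw [Finset.mem_erase]
    exact ⟨fun h => hab (h ▸ hx), hB'.1 hx⟩
  have h1 : M.eRk (B : Set α) ≤ M.eRk ((H.erase a : Finset α) : Set α) := M.eRk_mono (Finset.coe_subset.2 hsub)
  rw [hB'.2, eRk_erase_of_coloop hH ha hr hacl] at h1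
  have h2 : q + 1 ≤ q := by exact_mod_cast h1
  omega

/-- With a coloop `a` of `H` (`rk H = q + 1`), no rank-`(q + 1)` subset is demanded at type `q + 1`:
`H ∖ B ⊆ H ∖ a` has rank `≤ q`. -/
theorem dem_eq_zero_of_coloop {H B : Finset α} {a : α} {q : ℕ} (hH : H ⊆ gr M) (ha : a ∈ H)
    (hr : M.eRk (H : Set α) = ((q + 1 : ℕ) : ℕ∞)) (hacl : a ∉ M.closure ((H.erase a : Finset α) : Set α))
    (hB : B ∈ Rq M H (q + 1)) : dem M H (q + 1) B = 0 := by
  have haB := mem_of_mem_Rq_of_coloop hH ha hr hacl hB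
  unfold dem
  rw [if_pos]
  have hsub : H \ B ⊆ H.erase a := by
    intro x hx
    rw [Finset.mem_sdiff] at hx
    rw [Finset.mem_erase]
    exact ⟨fun h => hx.2 (h ▸ haB), hx.1⟩
  have h1 : M.eRk ((H \ B : Finset α) : Set α) ≤ M.eRk ((H.erase a : Finset α) : Set α) :=
    M.eRk_mono (Finset.coe_subset.2 hsub)
  rw [eRk_erase_of_coloop hH ha hr hacl] at h1
  have h2 : M.eRk ((H \ B : Finset α) : Set α) + 1 ≤ (q : ℕ∞) + 1 := add_le_add_left h1 1
  calc M.eRk ((H \ B : Finset α) : Set α) + 1 ≤ (q : ℕ∞) + 1 := h2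
    _ = ((q + 1 : ℕ) : ℕ∞) := by push_cast; rfl

/-- **The top-type trace sum of a set with a coloop is non-negative**: on a rank-`(q + 1)` set `H` with a coloop,
the level-`(q + 2)` trace sum at type `q + 1` has every summand `3/(2 + m(B)) ≥ 0`. -/
theorem traceSum_top_nonneg_of_coloop {H : Finset α} {a : α} {q : ℕ} (hH : H ⊆ gr M) (ha : a ∈ H)
    (hr : M.eRk (H : Set α) = ((q + 1 : ℕ) : ℕ∞)) (hacl : a ∉ M.closure ((H.erase a : Finset α) : Set α)) :
    0 ≤ ∑ B ∈ Rq M H (q + 1), ((((q + 1 + 1 : ℕ) : ℚ) + 2 - ((q + 1 : ℕ) : ℚ)) * (1 / (2 + (mTr M B : ℚ))) -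
      ((((q + 1 + 1 : ℕ) : ℚ) + 2) / (((q + 1 + 1 : ℕ) : ℚ) + 1)) * dem M H (q + 1) B) := by
  refine Finset.sum_nonneg (fun B hB => ?_)
  rw [dem_eq_zero_of_coloop hH ha hr hacl hB, mul_zero, sub_zero]
  apply mul_nonneg
  · push_cast; linarith
  · positivity

/-- The `TraceSixResidue` instances with `m(H) ≥ 1` at type `6`, verbatim (`q + 1 = 6`): a coloop exists by
`exists_coloop_of_mTr_ne_zero`. -/
theorem traceSum_six_top_nonneg_of_mTr_ne_zero {H : Finset α} (hH : H ⊆ gr M)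
    (hr : M.eRk (H : Set α) = ((6 : ℕ) : ℕ∞)) (hm : mTr M H ≠ 0) :
    0 ≤ ∑ B ∈ Rq M H 6, ((((6 + 1 : ℕ) : ℚ) + 2 - ((6 : ℕ) : ℚ)) * (1 / (2 + (mTr M B : ℚ))) -
      ((((6 + 1 : ℕ) : ℚ) + 2) / (((6 + 1 : ℕ) : ℚ) + 1)) * dem M H 6 B) := by
  obtain ⟨a, ha, hacl⟩ := exists_coloop_of_mTr_ne_zero hm
  have h := traceSum_top_nonneg_of_coloop (q := 5) hH ha (by exact_mod_cast hr) hacl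
  exact h

/-- **The trace sum of a set with a coloop is the SHIFTED trace sum of the set without it**: for `τ` of rank `q`
and `a ∉ cl(τ)`, the level-`L` trace sum on `τ ∪ {a}` at type `t` equals
`Σ_{B ∈ R_q(τ)} ((L + 2 − t)/(3 + m(B)) − ((L + 2)/(L + 1))·dem(τ, t, B))` — the weights shifted by the coloop
(`m(B ∪ a) = m(B) + 1`, `(τ ∪ a) ∖ (B ∪ a) = τ ∖ B`). -/
theorem traceSum_insert_eq_shifted {τ : Finset α} {a : α} {q : ℕ} (ha : a ∈ gr M) (haτ : a ∉ τ)
    (hacl : a ∉ M.closure (τ : Set α)) (hrτ : M.eRk (τ : Set α) = (q : ℕ∞)) (L t : ℕ) :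
    ∑ B ∈ Rq M (insert a τ) (q + 1), (((L : ℚ) + 2 - t) * (1 / (2 + (mTr M B : ℚ))) -
        (((L : ℚ) + 2) / ((L : ℚ) + 1)) * dem M (insert a τ) t B)
      = ∑ B ∈ Rq M τ q, (((L : ℚ) + 2 - t) * (1 / (3 + (mTr M B : ℚ))) -
        (((L : ℚ) + 2) / ((L : ℚ) + 1)) * dem M τ t B) := by
  rw [Rq_succ_eq_image_insert ha hacl hrτ,
    Finset.sum_image (fun B hB B' hB' h => insert_inj_of_subset haτ (mem_Rq.1 hB).1 (mem_Rq.1 hB').1 h)]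
  apply Finset.sum_congr rfl
  intro B hB
  have hBτ := (mem_Rq.1 hB).1
  have haB : a ∉ B := fun h => haτ (hBτ h)
  unfold dem
  rw [insert_sdiff_insert_eq haτ B, mTr_insert_eq_of_notMem_closure hacl hBτ haB]
  push_cast
  ring

/-- The `m(H) ≥ 1` instances of `TraceSixResidue` at type `t`, through the coloop: the level-`7` trace sum on `H`
(rank `6`, coloop `a`) is the level-`7` trace sum on `H ∖ a` (rank `5`) with the weights `1/(3 + m)`. -/
theorem traceSum_six_eq_shifted_of_coloop {H : Finset α} {a : α} (hH : H ⊆ gr M) (ha : a ∈ H)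
    (hr : M.eRk (H : Set α) = ((6 : ℕ) : ℕ∞)) (hacl : a ∉ M.closure ((H.erase a : Finset α) : Set α)) (t : ℕ) :
    ∑ B ∈ Rq M H 6, ((((6 + 1 : ℕ) : ℚ) + 2 - t) * (1 / (2 + (mTr M B : ℚ))) -
        ((((6 + 1 : ℕ) : ℚ) + 2) / (((6 + 1 : ℕ) : ℚ) + 1)) * dem M H t B)
      = ∑ B ∈ Rq M (H.erase a) 5, ((((6 + 1 : ℕ) : ℚ) + 2 - t) * (1 / (3 + (mTr M B : ℚ))) -
        ((((6 + 1 : ℕ) : ℚ) + 2) / (((6 + 1 : ℕ) : ℚ) + 1)) * dem M (H.erase a) t B) := by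
  have haG : a ∈ gr M := hH ha
  have hr5 : M.eRk ((H.erase a : Finset α) : Set α) = ((5 : ℕ) : ℕ∞) :=
    eRk_erase_of_coloop (q := 5) hH ha (by exact_mod_cast hr) hacl
  have key := traceSum_insert_eq_shifted (M := M) (τ := H.erase a) (q := 5) haG (Finset.notMem_erase a H) hacl hr5 7 t
  rw [Finset.insert_erase ha] at key
  have e : ((6 + 1 : ℕ) : ℚ) = (7 : ℚ) := by norm_num
  simp only [e]
  have key' := key
  simp only [show ((7 : ℕ) : ℚ) = (7 : ℚ) by norm_num] at key'
  exact key'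

/-- A coloop of `H ∖ a` is a coloop of `H` when `a` is a coloop of `H` (exchange): so `m(H) = 1` makes `H ∖ a` coloop-free. -/
theorem mem_coloopsOf_of_mem_coloopsOf_erase {H : Finset α} {a b : α} (ha : a ∈ H)
    (hacl : a ∉ M.closure ((H.erase a : Finset α) : Set α)) (hb : b ∈ coloopsOf M (H.erase a)) :
    b ∈ coloopsOf M H := by
  have hb' := mem_coloopsOf.1 hb
  have hbH : b ∈ H := Finset.mem_of_mem_erase hb'.1
  have hba : b ≠ a := Finset.ne_of_mem_erase hb'.1
  rw [mem_coloopsOf]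
  refine ⟨hbH, fun hcl => ?_⟩
  -- `H ∖ b = ((H ∖ a) ∖ b) ∪ {a}`; `b ∈ cl(X ∪ a)`, `b ∉ cl X` ⇒ `a ∈ cl(X ∪ b) = cl(H ∖ a)`
  have hX : ((H.erase b : Finset α) : Set α) = insert a (((H.erase a).erase b : Finset α) : Set α) := by
    rw [← Finset.coe_insert]
    congr 1
    ext x
    simp only [Finset.mem_erase, Finset.mem_insert]
    constructor
    · rintro ⟨hxb, hxH⟩
      by_cases hxa : x = a
      · exact Or.inl hxa
      · exact Or.inr ⟨hxb, hxa, hxH⟩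
    · rintro (rfl | ⟨hxb, _, hxH⟩)
      · exact ⟨fun h => hba h.symm, ha⟩
      · exact ⟨hxb, hxH⟩
  rw [hX] at hcl
  have hex := Matroid.closure_exchange (M := M) (e := b) (f := a) (X := (((H.erase a).erase b : Finset α) : Set α))
    ⟨hcl, hb'.2⟩
  apply hacl
  have h1 : insert b (((H.erase a).erase b : Finset α) : Set α) = ((H.erase a : Finset α) : Set α) := by
    rw [← Finset.coe_insert, Finset.insert_erase hb'.1]
  rw [h1] at hex
  exact hex.1

/-- `m(H) = 1` with coloop `a` ⇒ `m(H ∖ a) = 0`. -/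
theorem mTr_erase_eq_zero_of_mTr_eq_one {H : Finset α} {a : α} (ha : a ∈ H)
    (hacl : a ∉ M.closure ((H.erase a : Finset α) : Set α)) (hm : mTr M H = 1) : mTr M (H.erase a) = 0 := by
  unfold mTr at hm ⊢
  rw [Finset.card_eq_zero, Finset.eq_empty_iff_forall_notMem]
  intro b hb
  have hbH : b ∈ coloopsOf M H := mem_coloopsOf_of_mem_coloopsOf_erase ha hacl hb
  have haH : a ∈ coloopsOf M H := mem_coloopsOf.2 ⟨ha, hacl⟩
  have hba : b ≠ a := Finset.ne_of_mem_erase (mem_coloopsOf.1 hb).1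
  have h2 : 2 ≤ (coloopsOf M H).card := by
    have : ({a, b} : Finset α) ⊆ coloopsOf M H := by
      intro x hx
      simp only [Finset.mem_insert, Finset.mem_singleton] at hx
      rcases hx with rfl | rfl
      · exact haH
      · exact hbH
    have hc : ({a, b} : Finset α).card = 2 := Finset.card_pair (Ne.symm hba)
    rw [← hc]
    exact Finset.card_le_card this
  omega

/-- **The `m(H) = 1` instances of `TraceSixResidue` from the shifted certificates**: the level-`7` trace sum on `H`
(rank `6`, `m(H) = 1`, `|H| = 6 + d`) is non-negative at type `t` whenever the SHIFTED sum is non-negative on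
every coloop-free rank-`5` set of `5 + d` points. -/
theorem traceSum_six_nonneg_of_mTr_one_of_shifted {H : Finset α} {d : ℕ} (hH : H ⊆ gr M)
    (hr : M.eRk (H : Set α) = ((6 : ℕ) : ℕ∞)) (hm : mTr M H = 1) (hcard : H.card = 6 + d) (t : ℕ)
    (hsh : ∀ G : Finset α, G ⊆ gr M → M.eRk (G : Set α) = ((5 : ℕ) : ℕ∞) → G.card = 5 + d → mTr M G = 0 →
      0 ≤ ∑ B ∈ Rq M G 5, ((((6 + 1 : ℕ) : ℚ) + 2 - t) * (1 / (3 + (mTr M B : ℚ))) -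
        ((((6 + 1 : ℕ) : ℚ) + 2) / (((6 + 1 : ℕ) : ℚ) + 1)) * dem M G t B)) :
    0 ≤ ∑ B ∈ Rq M H 6, ((((6 + 1 : ℕ) : ℚ) + 2 - t) * (1 / (2 + (mTr M B : ℚ))) -
      ((((6 + 1 : ℕ) : ℚ) + 2) / (((6 + 1 : ℕ) : ℚ) + 1)) * dem M H t B) := by
  obtain ⟨a, ha, hacl⟩ := exists_coloop_of_mTr_ne_zero (M := M) (G := H) (by rw [hm]; exact one_ne_zero)
  rw [traceSum_six_eq_shifted_of_coloop hH ha hr hacl t]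
  apply hsh
  · exact (Finset.erase_subset a H).trans hH
  · exact eRk_erase_of_coloop (q := 5) hH ha (by exact_mod_cast hr) hacl
  · rw [Finset.card_erase_of_mem ha, hcard]; omega
  · exact mTr_erase_eq_zero_of_mTr_eq_one ha hacl hm

end PercRepro.GenQ
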